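import Summits.ResolutionOfSingularities.ResolutionOfSingularities.Theorems.FrobeniusClosingPatchingRelPerfectDepthOneDictionary
import HarnessLib

/-!
# Crux `PatchingRelPerfect` (stmt-ResolutionOfSingularities-16161), chain w52 — programme r-d1,
# the LAYERED FORMAT LEMMA (general layer number `ℓ`, ring level)

[OURS · L1 W5.2 · r-d1] CRUX-PLAN v3.1 §6e «General ℓ (for R4 and beyond)» = tri-1 HUNT §8b FORMAT
LEMMA, as ONE chart identity over ANY commutative ring.  Data: `u ∈ R` (the exceptional / `E`
equation), `z : Fin c → R`, `x = (u, z)`, `P = (u, z)` (the centre `Z × 0`), and a finite family of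
LAYERS `(d_j, n_j, L_j)`: `u`-degree `d_j`, an ideal `L_j ≤ P^{n_j}` (order `≥ n_j` along the
centre; `L_j` = boundary monomial `M_j` times layer ideal `𝔡̃_j` in tri-1's notation, `n_j = ord_Z M_j
+ ν_j`), `K = Σ_j u^{d_j} · L_j`; a shift `m ≤ d_j + n_j` for all `j`.  PROVED in the image model
`R[P/x_i] ⊆ R[1/x_i]` (`DepthOne.map_algebraMap_layer`, `DepthOne.map_algebraMap_layers`; the
controlled transform of order `n` in both models, `…_eq_span_pow_mul_colon`): on the chart of `x_i`,

  `K · B_i = (x_iᵐ) · Σ_j (x_i^{d_j + n_j − m}) · (e_u^{d_j}) · (L_j B_i : x_i^{n_j})`,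

`e_u = u/x_i` (so `e_u = 1` on the `u`-chart, where the new layers are indexed by the exponent
`d_j + n_j − m` of the NEW exceptional equation `u`: the top layer `L = R`, `n = 0`, `d = ℓ` lands at
`ℓ − m` — «the u-chart drops to `ℓ′ = ℓ − m`»; on a `z_i`-chart `e_u = u′` is the strict transform of
`E` and the layers keep their index `d_j`, acquiring the boundary monomial `z_i^{d_j + n_j − m}` —
«z-charts keep the format»).  `ℓ = 1` (`K = (u) + 𝔟`, layers `(1, 0, R)` and `(0, 1, 𝔟)`, `m = 1`)
is D1's S-side identity (`…DepthOneDictionary.lean`).  The identity is exact for the GIVEN bounds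
`n_j`; which presentation of the new layers is again `u`-free (normal conicity, HUNT §8a) is not a
ring-level statement and is not claimed.  Nothing here is a statement of the manuscript under review.

## References

* U. Görtz, T. Wedhorn, *Algebraic Geometry I* (2nd ed., 2020), (13.19) p. 415, Prop. 13.96 (2).
  [GortzWedhorn2020]
* The Stacks Project, Tags 0804, 0BIQ. [StacksProject]
-/

-- `Summit.<Summit>.<Sub>.Theorems` with `Sub = Summit` (single-conjunct summit, D-0017)
set_option linter.dupNamespace false

noncomputable section

open CategoryTheory CategoryTheory.Limits AlgebraicGeometry Literature.AlgebraicGeometry.Resolution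

namespace Summit.ResolutionOfSingularities.ResolutionOfSingularities.Theorems

universe u

namespace DepthOne

section ChartRing

variable {R : Type u} [CommRing R] {c : ℕ} (u : R) (z : Fin c → R) (i : Fin (c + 1))

local notation3 "xx" => (Fin.cons u z : Fin (c + 1) → R)
local notation3 "P" => Ideal.span (Set.range (Fin.cons u z : Fin (c + 1) → R))
local notation3 "φ" => chartBase (Fin.cons u z : Fin (c + 1) → R) i
local notation3 "e₀" => chartGen (Fin.cons u z : Fin (c + 1) → R) i 0

/-- **Controlled transform of order `n`**: for `L ≤ Pⁿ`, `L · B_i = (x_iⁿ) · (L B_i : x_iⁿ)`.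
[cite: StacksProject, Tag 0804] -/
theorem map_chartBase_eq_span_pow_mul_colon {L : Ideal R} {n : ℕ} (hL : L ≤ P ^ n) :
    L.map φ = Ideal.span {φ (xx i) ^ n} * (L.map φ).colon {φ (xx i) ^ n} := by
  refine eq_span_singleton_mul_colon ((Ideal.map_mono hL).trans ?_)
  rw [Ideal.map_pow, map_reesChartBase_eq (xx i) (Ideal.mem_span_range_self (f := xx) (x := i)),
    Ideal.span_singleton_pow]

end ChartRing

/-! ## The same in the image model `R[P/x_i] ⊆ R[1/x_i]` -/

section ImageModel

variable {R : Type u} [CommRing R] {c : ℕ} (u : R) (z : Fin c → R) (i : Fin (c + 1))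

local notation3 "xx" => (Fin.cons u z : Fin (c + 1) → R)
local notation3 "P" => Ideal.span (Set.range (Fin.cons u z : Fin (c + 1) → R))
local notation3 "α" => algebraMap R (blowupAlgebra (Ideal.span (Set.range (Fin.cons u z : Fin (c + 1) → R)))
  ((Fin.cons u z : Fin (c + 1) → R) i))
local notation3 "f₀" => blowupAlgebra.frac (Fin.cons u z : Fin (c + 1) → R) i 0

/-- **Controlled transform of order `n` (image model)**: `L · R[P/x_i] = (x_iⁿ) · (L R[P/x_i] : x_iⁿ)`
for `L ≤ Pⁿ`. [cite: StacksProject, Tag 0804] -/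
theorem map_algebraMap_eq_span_pow_mul_colon {L : Ideal R} {n : ℕ} (hL : L ≤ P ^ n) :
    L.map α = Ideal.span {α (xx i) ^ n} * (L.map α).colon {α (xx i) ^ n} := by
  refine eq_span_singleton_mul_colon ((Ideal.map_mono hL).trans ?_)
  rw [Ideal.map_pow, map_blowupAlgebra_eq_span (blowupAlgebra.mem_span_range xx i),
    Ideal.span_singleton_pow]

/-- **One layer (image model)**: `(u^d · L) · R[P/x_i] = (x_iᵐ)·((x_i^{d+n−m})·((u/x_i)^d·(L : x_iⁿ)))`.
[cite: GortzWedhorn2020, (13.19) p. 415] -/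
theorem map_algebraMap_layer {L : Ideal R} {d n m : ℕ} (hL : L ≤ P ^ n) (hm : m ≤ d + n) :
    (Ideal.span {u ^ d} * L).map α =
      Ideal.span {α (xx i) ^ m} * (Ideal.span {α (xx i) ^ (d + n - m)} *
        (Ideal.span {f₀ ^ d} * (L.map α).colon {α (xx i) ^ n})) := by
  have hue : α u = α (xx i) * f₀ := algebraMap_eq_mul_frac u z i 0
  have hud : α (u ^ d) = α (xx i) ^ d * f₀ ^ d := by rw [map_pow, hue]; ring
  obtain ⟨k, hk, hk'⟩ : ∃ k, d + n = m + k ∧ d + n - m = k := ⟨d + n - m, by omega, rfl⟩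
  have hpow : α (xx i) ^ d * α (xx i) ^ n = α (xx i) ^ m * α (xx i) ^ k :=
    (pow_add _ d n).symm.trans (hk ▸ pow_add _ m k)
  have hgen : α (xx i) ^ d * f₀ ^ d * α (xx i) ^ n = α (xx i) ^ m * α (xx i) ^ k * f₀ ^ d :=
    calc α (xx i) ^ d * f₀ ^ d * α (xx i) ^ n = α (xx i) ^ d * α (xx i) ^ n * f₀ ^ d := by ring
      _ = α (xx i) ^ m * α (xx i) ^ k * f₀ ^ d := by rw [hpow]
  rw [hk']
  conv_lhs => rw [Ideal.map_mul, Ideal.map_span, Set.image_singleton, hud,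
    map_algebraMap_eq_span_pow_mul_colon u z i hL, ← mul_assoc, Ideal.span_singleton_mul_span_singleton,
    hgen, ← Ideal.span_singleton_mul_span_singleton, ← Ideal.span_singleton_mul_span_singleton]
  rw [mul_assoc, mul_assoc]

/-- **THE LAYERED FORMAT LEMMA (image model).** [cite: GortzWedhorn2020, Prop. 13.96 (2)]
[cite: StacksProject, Tag 0804] -/
theorem map_algebraMap_layers {ι : Type*} (s : Finset ι) (L : ι → Ideal R) (d n : ι → ℕ)
    (hL : ∀ j ∈ s, L j ≤ P ^ n j) (m : ℕ) (hm : ∀ j ∈ s, m ≤ d j + n j) :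
    (⨆ j ∈ s, Ideal.span {u ^ d j} * L j).map α =
      Ideal.span {α (xx i) ^ m} *
        ⨆ j ∈ s, Ideal.span {α (xx i) ^ (d j + n j - m)} *
          (Ideal.span {f₀ ^ d j} * ((L j).map α).colon {α (xx i) ^ n j}) := by
  rw [Ideal.map_iSup, Ideal.mul_iSup]
  refine iSup_congr fun j => ?_
  rw [Ideal.map_iSup, Ideal.mul_iSup]
  refine iSup_congr fun hj => ?_
  exact map_algebraMap_layer u z i (hL j hj) (hm j hj)

end ImageModel



end DepthOne

end Summit.ResolutionOfSingularities.ResolutionOfSingularities.Theorems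

end
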